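import Summits.QuantumFields.YangMills.Theorems.LangevinControlUVOSLegsAtWeakCouplingCSketchGermWard
import HarnessLib

/-!
# Crux `OSLegsAtWeakCouplingC` (stmt-QuantumFields-16207), line `Sketch`: the imports in their weakest consumed form

Support file (continuation lead c4).  The landed compositions of line `Sketch` (`osLegsAtWeakCouplingC_of_fcp6_germ`
p133906, `…_of_fcp6_germRot` p135054, `…_of_fcp6_germWard` p135824) take the hypothesis-side import
`DlrCollarTransfer.Statement.stub_fcp6` (pinned periodic femto packages ⇒ the frozen-boundary femto package
`FBL6 ∧ FC2 ∧ FC3`, uniformly over exteriors).  Reading the landed proof `conclC_of_stubs_germRot` shows that the line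
CONSUMES from that package exactly two OUTPUT-LEVEL lattice statements, both already defined in the route's Defs file
and both derived there from `stub_fcp6` by landed stubs:

* **E0′** — `MomentBounds6 G r a` (volume-uniform hyperscaling: on EVERY odd torus, at `β ≥ β₄`, the centred mixed
  moment of `n` single-plane plaquette fields at pairwise torus sup-distance `≥ 2R+4`, `R a(β) ≤ ℓ₄`, is at most
  `(C/R⁴)ⁿ`), obtained from `FBL6` by `stub_collar6`;
* **NT** — `LowerBounds G r a` (k-free lower bounds for the smeared truncated two-point function `Q2(θv, v)` and the
  smeared connected three-point function `Q3(f, g, h)` of the action density on LARGE tori), obtained from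
  `FBL6 ∧ FC2 ∧ FC3` by `fbl_of_fbl6` and `stub_lower`.

Hence the hypothesis-side import may be re-typed, at no cost to the composition, as the pair of strictly weaker statements
"crux hypotheses (`Continuous a`, H1, H2, H3) ⇒ `MomentBounds6`" and "crux hypotheses ⇒ `LowerBounds`" — free of the
line-internal frozen-boundary machinery (cubes, exteriors `η`, collar depths `K(s₀)`), and literally two of the three
named hard legs of the item (E0′ uniform in the volume; femto → large-torus decoupling = non-triviality on large tori).
This file records:

* `conclC_of_outputs_germRot` / `osLegsAtWeakCouplingC_of_outputs_germRot` — the composition from the two output-level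
  imports and the det-1 planar germ import, the latter now also allowed to assume `MomentBounds6` and `LowerBounds`;
* `osLegsAtWeakCouplingC_of_outputs_germWard` — **the crux BY NAME from E0′, NT and the rotation Ward identity on the
  germ** (the registered skeleton v7: stubs `stub_momentBounds`, `stub_lowerBounds`, `stub_germWard`);
* `momentBounds_of_stub_fcp6`, `lowerBounds_of_stub_fcp6` — the new imports are implied by the old one;
* `germRotAt_of_latticeWardAt`, `osLegsAtWeakCouplingC_of_outputs_latticeWard` — the E1 import in LATTICE form: along every
  scheme in units `a` with `β_k → ∞` and the bundle's torus ranges, the rotation-Ward defect of the lattice `n`-point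
  distribution `latticeDist` (centred, `c = a⁻⁴`) tends to `0` on the germ; by the bundle's convergence clause and
  uniqueness of limits this gives the Ward identity on the germ, hence the crux.  This typing is stronger than `GermWard`
  but mentions no limit object: it is a statement about lattice Yang–Mills alone (the natural target of a lattice
  rotation-Ward-identity argument: insertions of the dimension-6 rotation-breaking part of the Wilson action vanish in
  units `a`).

Tree vocabulary only; no definitions.  Refs: OsterwalderSchrader1973 §4.2; OsterwalderSchrader1975; GlimmJaffe1987
§6.1/§19; JaffeWitten2000 §4/§6; Balaban1989LargeFieldII (E0′ as engine output).
-/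

set_option autoImplicit false

noncomputable section

open scoped SchwartzMap ComplexConjugate BigOperators
open MeasureTheory Filter Topology
open Literature.MathematicalPhysics.QuantumFieldTheory Literature.MathematicalPhysics.QuantumLattice
open Literature.MathematicalPhysics.AQFT Literature.Probability.LatticeModels
open Summit.QuantumFields.YangMills.Theses.LangevinControlUV (OSLegsAtWeakCouplingC)
open Summit.QuantumFields.YangMills.Cruxes.OSLegsFromFemtoAndGap.DlrCollarTransfer
open Summit.QuantumFields.YangMills.Theorems.OSLegsFromFemtoAndGap (isHermitian_of_isReflectionPositive latticeDist)
open Summit.QuantumFields.YangMills.Theorems.HypercubicLimit.Negative (onlySpecies extendByZero)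
open Summit.QuantumFields.YangMills.Theorems.NPointIsotropy.Negative (E4)
open Summit.QuantumFields.YangMills.Theorems.NPointIsotropy.ComplexRotationBandlimit.Mopup (exists_eq_planeRot)

namespace Summit.QuantumFields.YangMills.Cruxes.OSLegsAtWeakCouplingC.Sketch

/-! ## §1 The composition from the output-level imports -/

section Composition

variable {G : Type} [Group G] [TopologicalSpace G] [IsTopologicalGroup G] [CompactSpace G]
  [MeasurableSpace G] [BorelSpace G]

/-- **The line composed from the output-level imports**: E0′ (`MomentBounds6`) and NT (`LowerBounds`) under the crux
hypotheses, `stub_rope`, `stub_hypercubic`, `stub_locality`, and germ invariance under det-1 planar isometries — assumed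
only for soft-bundle limits that are `RPPos`, density-bounded and signed-permutation invariant, with H1–H3, continuity,
`MomentBounds6` and `LowerBounds` in hand — give `ConclC` for every compact simple `G`, every `r`, every continuous unit map
carrying H1, H2, H3 (the landed `conclC_of_stubs_germRot` with the femto package replaced by its two consumed outputs). -/
theorem conclC_of_outputs_germRot
    (hMB : ∀ (G : Type) [Group G] [TopologicalSpace G] [IsTopologicalGroup G] [CompactSpace G]
      [MeasurableSpace G] [BorelSpace G], IsCompactSimpleLieGroup G →
      ∀ (r : LatticeRep G) (a : ℝ → ℝ), Continuous a → TwoPoint G r a → Skewness G r a → GapInUnits G r a →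
        MomentBounds6 G r a)
    (hLB : ∀ (G : Type) [Group G] [TopologicalSpace G] [IsTopologicalGroup G] [CompactSpace G]
      [MeasurableSpace G] [BorelSpace G], IsCompactSimpleLieGroup G →
      ∀ (r : LatticeRep G) (a : ℝ → ℝ), Continuous a → TwoPoint G r a → Skewness G r a → GapInUnits G r a →
        LowerBounds G r a)
    (hrope : Statement.stub_rope) (hhyp : Statement.stub_hypercubic)
    (hgerm : ∀ (G : Type) [Group G] [TopologicalSpace G] [IsTopologicalGroup G] [CompactSpace G]
      [MeasurableSpace G] [BorelSpace G], IsCompactSimpleLieGroup G →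
      ∀ (r : LatticeRep G) (a : ℝ → ℝ) (sch : SpeciesScheme (YMSpecies G)) (S₁ : SchwingerFamily E4)
        (Tq : (n : ℕ) → (Fin n → Fin 4 × Fin 4) → (𝓢((Fin n → E4), ℂ) →L[ℂ] ℂ)) (K : ℝ) (b₀ : ℝ) (g : ℝ → ℕ → ℕ),
        Continuous a → TwoPoint G r a → Skewness G r a → GapInUnits G r a → MomentBounds6 G r a → LowerBounds G r a →
        SoftBundle G r a sch S₁ Tq K b₀ g →
        RPPos S₁ → OffDiagDensity S₁ → (∀ R : E4 ≃ₗᵢ[ℝ] E4, IsSignedPerm R → Invariant S₁ R) →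
          ∃ r₀ : ℝ, 0 < r₀ ∧ ∀ R : E4 ≃ₗᵢ[ℝ] E4, LinearMap.det (R.toLinearEquiv : E4 →ₗ[ℝ] E4) = 1 →
            IsPlanar01 R → GermInvariant S₁ R r₀)
    (hloc : Statement.stub_locality)
    (hG : IsCompactSimpleLieGroup G) (r : LatticeRep G) (a : ℝ → ℝ) (ha : Continuous a)
    (h1 : TwoPoint G r a) (h2 : Skewness G r a) (h3 : GapInUnits G r a) : ConclC G r a := by
  -- positivity and the limit of the unit map, from H1
  obtain ⟨-, -, -, -, -, -, -, hapos, ha0, -, -⟩ := id h1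
  -- hypothesis side: the two output-level imports
  have hMB6 : MomentBounds6 G r a := hMB G hG r a ha h1 h2 h3
  have hLB' : LowerBounds G r a := hLB G hG r a ha h1 h2 h3
  -- the rope's demands, then the soft bundle meeting them
  obtain ⟨b₀, g, Δ, hΔ, hRD⟩ := hrope G r a hapos ha0 h3
  obtain ⟨sch, S₁, Tq, K, hB⟩ := stub_growth G r a hapos ha0 hMB6 hLB' h3 b₀ g
  obtain ⟨hRP, hDec⟩ := hRD sch S₁ Tq K hB
  have hsigned : ∀ R : E4 ≃ₗᵢ[ℝ] E4, IsSignedPerm R → Invariant S₁ R :=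
    fun R hR n F hF => hhyp G r a sch S₁ Tq K b₀ g hB n R hR F hF
  have hdens : OffDiagDensity S₁ := stub_density G r a sch S₁ Tq K b₀ g hMB6 hB
  -- the germ import, fed with everything the line has proved about `S₁`
  obtain ⟨r₀, hr₀, hgermR⟩ := hgerm G hG r a sch S₁ Tq K b₀ g ha h1 h2 h3 hMB6 hLB' hB hRP hdens hsigned
  -- unpack the bundle
  obtain ⟨⟨hunits, -, -, hβ, hN, hLG, hE3, htrans, h0, h1', -, -, hYM, hnt, hng, ⟨Δ', hΔ', hlat⟩, -⟩, -⟩ := hB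
  -- continuum side
  obtain ⟨hCS, hgapOf⟩ := stub_gap S₁ h0 htrans hRP
  have hE4 : S₁.toLabelled.HasClusterProperty :=
    stub_cluster S₁ Δ hΔ h0 h1' htrans (fun n R hR F hF => hsigned R hR n F hF) hCS hDec
  have hplanar : ∀ R : E4 ≃ₗᵢ[ℝ] E4, LinearMap.det (R.toLinearEquiv : E4 →ₗ[ℝ] E4) = 1 → IsPlanar01 R →
      Invariant S₁ R := fun R hdet hR =>
    hloc S₁ h0 htrans hE3 hLG hRP hsigned hdens R hR r₀ hr₀ (hgermR R hdet hR)
  have hE1 : S₁.toLabelled.IsEuclideanInvariant := isEuclideanInvariant_of_planarRot S₁ htrans hsigned hplanar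
  have hE2 : S₁.toLabelled.IsReflectionPositive := isReflectionPositive_of_rpPos hRP
  have hherm : S₁.toLabelled.IsHermitian := isHermitian_of_isReflectionPositive S₁ hN hE2
  have hOS : OSAxiomsSchwinger S₁.toLabelled :=
    { normalized := hN, hermitian := hherm, invariant := hE1, reflectionPositive := hE2, symmetric := hE3,
      cluster := hE4, linearGrowth := hLG }
  have hgap : S₁.toLabelled.HasMassGap Δ := hgapOf Δ hΔ hDec
  -- one field extended by zero to all species
  have hnt' : ∃ (F₁ G₁ : 𝓢((Fin 1 → E4), ℂ)) (H₁ : 𝓢((Fin (1 + 1) → E4), ℂ)),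
      IsTimeOrdered F₁ ∧ IsTimeOrdered G₁ ∧ IsAppendTensorOf H₁ (osAdjoint F₁) G₁ ∧
        S₁ (1 + 1) H₁ ≠ S₁ 1 (osAdjoint F₁) * S₁ 1 G₁ := by
    simpa using hnt
  have hng' : ∃ (f g h : 𝓢(E4, ℂ)) (Ffgh : 𝓢((Fin 3 → E4), ℂ)) (Fgh Ffh Ffg : 𝓢((Fin 2 → E4), ℂ))
      (Ff Fg Fh : 𝓢((Fin 1 → E4), ℂ)),
      IsTensorOf Ffgh ![f, g, h] ∧ IsOffDiagonal Ffgh ∧ IsTensorOf Fgh ![g, h] ∧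
      IsTensorOf Ffh ![f, h] ∧ IsTensorOf Ffg ![f, g] ∧ IsTensorOf Ff ![f] ∧ IsTensorOf Fg ![g] ∧
      IsTensorOf Fh ![h] ∧
        S₁ 3 Ffgh - S₁ 1 Ff * S₁ 2 Fgh - S₁ 1 Fg * S₁ 2 Ffh - S₁ 1 Fh * S₁ 2 Ffg +
          2 * (S₁ 1 Ff * S₁ 1 Fg * S₁ 1 Fh) ≠ 0 := by
    simpa using hng
  obtain ⟨T, hYM', hntT, hngT⟩ := exists_osData_of_oneField r sch S₁ hOS hYM hnt' hng'
  exact ⟨onlySpecies sch r.curvature, T, hunits, hβ, hYM', hntT, hngT, Δ', hΔ', hlat⟩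

end Composition

/-- **The crux from the output-level imports and the det-1 planar germ import** (conditional result):
`OSLegsAtWeakCouplingC` BY NAME from E0′ (`MomentBounds6`) and NT (`LowerBounds`) under the crux hypotheses, and germ
invariance under det-1 isometries of the `(x₀,x₁)`-plane along soft bundles; `stub_rope`, `stub_hypercubic`,
`stub_locality` are discharged by the landed theorems. -/
theorem osLegsAtWeakCouplingC_of_outputs_germRot
    (hMB : ∀ (G : Type) [Group G] [TopologicalSpace G] [IsTopologicalGroup G] [CompactSpace G]
      [MeasurableSpace G] [BorelSpace G], IsCompactSimpleLieGroup G →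
      ∀ (r : LatticeRep G) (a : ℝ → ℝ), Continuous a → TwoPoint G r a → Skewness G r a → GapInUnits G r a →
        MomentBounds6 G r a)
    (hLB : ∀ (G : Type) [Group G] [TopologicalSpace G] [IsTopologicalGroup G] [CompactSpace G]
      [MeasurableSpace G] [BorelSpace G], IsCompactSimpleLieGroup G →
      ∀ (r : LatticeRep G) (a : ℝ → ℝ), Continuous a → TwoPoint G r a → Skewness G r a → GapInUnits G r a →
        LowerBounds G r a)
    (hgerm : ∀ (G : Type) [Group G] [TopologicalSpace G] [IsTopologicalGroup G] [CompactSpace G]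
      [MeasurableSpace G] [BorelSpace G], IsCompactSimpleLieGroup G →
      ∀ (r : LatticeRep G) (a : ℝ → ℝ) (sch : SpeciesScheme (YMSpecies G)) (S₁ : SchwingerFamily E4)
        (Tq : (n : ℕ) → (Fin n → Fin 4 × Fin 4) → (𝓢((Fin n → E4), ℂ) →L[ℂ] ℂ)) (K : ℝ) (b₀ : ℝ) (g : ℝ → ℕ → ℕ),
        Continuous a → TwoPoint G r a → Skewness G r a → GapInUnits G r a → MomentBounds6 G r a → LowerBounds G r a →
        SoftBundle G r a sch S₁ Tq K b₀ g →
        RPPos S₁ → OffDiagDensity S₁ → (∀ R : E4 ≃ₗᵢ[ℝ] E4, IsSignedPerm R → Invariant S₁ R) →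
          ∃ r₀ : ℝ, 0 < r₀ ∧ ∀ R : E4 ≃ₗᵢ[ℝ] E4, LinearMap.det (R.toLinearEquiv : E4 →ₗ[ℝ] E4) = 1 →
            IsPlanar01 R → GermInvariant S₁ R r₀) :
    OSLegsAtWeakCouplingC := by
  rw [cruxC_iff]
  intro G _ _ _ _ hG
  letI : MeasurableSpace G := borel G
  haveI : BorelSpace G := ⟨rfl⟩
  intro r a ha h1 h2 h3
  exact conclC_of_outputs_germRot hMB hLB stub_rope stub_hypercubic hgerm stub_locality hG r a ha h1 h2 h3

/-- **The crux from E0′, NT and the rotation Ward identity on the germ** (conditional result; the registered skeleton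
v7 of line `Sketch`): `OSLegsAtWeakCouplingC` BY NAME from `MomentBounds6` and `LowerBounds` under the crux hypotheses
and `GermWard` (`germRot_of_germWard`, then `osLegsAtWeakCouplingC_of_outputs_germRot`, the extra hypotheses of the
germ import being dropped). -/
theorem osLegsAtWeakCouplingC_of_outputs_germWard
    (hMB : ∀ (G : Type) [Group G] [TopologicalSpace G] [IsTopologicalGroup G] [CompactSpace G]
      [MeasurableSpace G] [BorelSpace G], IsCompactSimpleLieGroup G →
      ∀ (r : LatticeRep G) (a : ℝ → ℝ), Continuous a → TwoPoint G r a → Skewness G r a → GapInUnits G r a →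
        MomentBounds6 G r a)
    (hLB : ∀ (G : Type) [Group G] [TopologicalSpace G] [IsTopologicalGroup G] [CompactSpace G]
      [MeasurableSpace G] [BorelSpace G], IsCompactSimpleLieGroup G →
      ∀ (r : LatticeRep G) (a : ℝ → ℝ), Continuous a → TwoPoint G r a → Skewness G r a → GapInUnits G r a →
        LowerBounds G r a)
    (hward : ∀ (G : Type) [Group G] [TopologicalSpace G] [IsTopologicalGroup G] [CompactSpace G]
      [MeasurableSpace G] [BorelSpace G], IsCompactSimpleLieGroup G →
      ∀ (r : LatticeRep G) (a : ℝ → ℝ) (sch : SpeciesScheme (YMSpecies G)) (S₁ : SchwingerFamily E4)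
        (Tq : (n : ℕ) → (Fin n → Fin 4 × Fin 4) → (𝓢((Fin n → E4), ℂ) →L[ℂ] ℂ)) (K : ℝ) (b₀ : ℝ) (g : ℝ → ℕ → ℕ),
        Continuous a → TwoPoint G r a → Skewness G r a → GapInUnits G r a → SoftBundle G r a sch S₁ Tq K b₀ g →
        RPPos S₁ → OffDiagDensity S₁ → (∀ R : E4 ≃ₗᵢ[ℝ] E4, IsSignedPerm R → Invariant S₁ R) →
          ∃ r₀ : ℝ, 0 < r₀ ∧ ∀ (n : ℕ), 2 ≤ n → ∀ (F D : 𝓢((Fin n → E4), ℂ)), IsOffDiagonal F →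
            HasCompactSupport (F : (Fin n → E4) → ℂ) →
            (∃ δ : ℝ, 0 < δ ∧ tsupport (F : (Fin n → E4) → ℂ) ⊆ Separated n δ) →
            tsupport (F : (Fin n → E4) → ℂ) ⊆ SmallDiam n r₀ →
            (∀ x, D x = fderiv ℝ (F : (Fin n → E4) → ℂ) x
              (fun k => (x k 0) • (EuclideanSpace.single 1 1 : E4) - (x k 1) • (EuclideanSpace.single 0 1 : E4))) →
            S₁ n D = 0) :
    OSLegsAtWeakCouplingC :=
  osLegsAtWeakCouplingC_of_outputs_germRot hMB hLB
    fun G _ _ _ _ _ _ hG r a sch S₁ Tq K b₀ g ha h1 h2 h3 _ _ hB hRP hdens hsigned =>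
      germRot_of_germWard hward G hG r a sch S₁ Tq K b₀ g ha h1 h2 h3 hB hRP hdens hsigned

/-! ## §2 The output-level imports are implied by `stub_fcp6` -/

/-- E0′ from the frozen-boundary femto package: `stub_fcp6 ⇒ MomentBounds6` under the crux hypotheses (pin by
`stubPin_of_continuous`, then `stub_collar6`). -/
theorem momentBounds_of_stub_fcp6 (hfcp : Statement.stub_fcp6) :
    ∀ (G : Type) [Group G] [TopologicalSpace G] [IsTopologicalGroup G] [CompactSpace G]
      [MeasurableSpace G] [BorelSpace G], IsCompactSimpleLieGroup G →
      ∀ (r : LatticeRep G) (a : ℝ → ℝ), Continuous a → TwoPoint G r a → Skewness G r a → GapInUnits G r a →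
        MomentBounds6 G r a := by
  intro G _ _ _ _ _ _ hG r a ha h1 h2 h3
  exact stub_collar6 G r a (hfcp G hG r a (stubPin_of_continuous G hG r a ha h1 h3) h2).1

/-- NT from the frozen-boundary femto package: `stub_fcp6 ⇒ LowerBounds` under the crux hypotheses (pin, then
`fbl_of_fbl6` and `stub_lower`). -/
theorem lowerBounds_of_stub_fcp6 (hfcp : Statement.stub_fcp6) :
    ∀ (G : Type) [Group G] [TopologicalSpace G] [IsTopologicalGroup G] [CompactSpace G]
      [MeasurableSpace G] [BorelSpace G], IsCompactSimpleLieGroup G →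
      ∀ (r : LatticeRep G) (a : ℝ → ℝ), Continuous a → TwoPoint G r a → Skewness G r a → GapInUnits G r a →
        LowerBounds G r a := by
  intro G _ _ _ _ _ _ hG r a ha h1 h2 h3
  obtain ⟨-, -, -, -, -, -, -, hapos, ha0, -, -⟩ := id h1
  obtain ⟨hFBL6, hFC2, hFC3⟩ := hfcp G hG r a (stubPin_of_continuous G hG r a ha h1 h3) h2
  exact stub_lower G r a hapos ha0 (fbl_of_fbl6 r a hFBL6) hFC2 hFC3

/-! ## §3 The E1 import in lattice form -/

section LatticeWard

variable {n : ℕ}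

/-- The generator derivative `D` of `F` is supported inside `tsupport F`. -/
theorem tsupport_rotDeriv_subset (F D : 𝓢((Fin n → E4), ℂ))
    (hD : ∀ x, D x = fderiv ℝ (F : (Fin n → E4) → ℂ) x
      (fun k => (x k 0) • (EuclideanSpace.single 1 1 : E4) - (x k 1) • (EuclideanSpace.single 0 1 : E4))) :
    tsupport (D : (Fin n → E4) → ℂ) ⊆ tsupport (F : (Fin n → E4) → ℂ) := by
  refine closure_minimal (fun x hx => ?_) (isClosed_tsupport _)
  by_contra hx'
  apply hx
  show D x = 0
  rw [hD x, fderiv_of_notMem_tsupport ℝ hx']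
  rfl

variable {G : Type} [Group G] [TopologicalSpace G] [IsTopologicalGroup G] [CompactSpace G]
  [MeasurableSpace G] [BorelSpace G]

/-- **Lattice Ward defect → 0 along the scheme ⇒ det-1 planar germ invariance of the bundle's limit.**  For a soft
bundle whose limit `S₁` has bounded densities off the diagonal: if for every `n ≥ 2` and every compactly supported,
separated, off-diagonal `F` of diameter `< r₀` the lattice `n`-point distributions of the scheme annihilate the generator
derivative `D` of `F` in the limit `k → ∞`, then (bundle convergence `latticeDist_k n D → S₁ n D` and uniqueness of
limits) `S₁ n D = 0`, so every `planeRot 0 φ` — i.e. every det-1 isometry of the `(x₀,x₁)`-plane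
(`Mopup.exists_eq_planeRot`) — fixes the germ (`germInvariant_planeRot_of_ward`). -/
theorem germRotAt_of_latticeWardAt (r : LatticeRep G) (a : ℝ → ℝ) (sch : SpeciesScheme (YMSpecies G))
    (S₁ : SchwingerFamily E4) (Tq : (n : ℕ) → (Fin n → Fin 4 × Fin 4) → (𝓢((Fin n → E4), ℂ) →L[ℂ] ℂ))
    (K : ℝ) (b₀ : ℝ) (g : ℝ → ℕ → ℕ) (hB : SoftBundle G r a sch S₁ Tq K b₀ g) (hdens : OffDiagDensity S₁)
    {r₀ : ℝ} (hr₀ : 0 < r₀)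
    (hlat : ∀ (n : ℕ), 2 ≤ n → ∀ (F D : 𝓢((Fin n → E4), ℂ)), IsOffDiagonal F →
      HasCompactSupport (F : (Fin n → E4) → ℂ) →
      (∃ δ : ℝ, 0 < δ ∧ tsupport (F : (Fin n → E4) → ℂ) ⊆ Separated n δ) →
      tsupport (F : (Fin n → E4) → ℂ) ⊆ SmallDiam n r₀ →
      (∀ x, D x = fderiv ℝ (F : (Fin n → E4) → ℂ) x
        (fun k => (x k 0) • (EuclideanSpace.single 1 1 : E4) - (x k 1) • (EuclideanSpace.single 0 1 : E4))) →
      Tendsto (fun k => latticeDist r.ρ (sch.β k) (sch.L k) (sch.a k) r.curvature.F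
        (wilsonTorusMean r.ρ (sch.β k) (sch.L k) r.curvature.F) n D) atTop (𝓝 0)) :
    ∃ r₀ : ℝ, 0 < r₀ ∧ ∀ R : E4 ≃ₗᵢ[ℝ] E4, LinearMap.det (R.toLinearEquiv : E4 →ₗ[ℝ] E4) = 1 →
      IsPlanar01 R → GermInvariant S₁ R r₀ := by
  -- the bundle's one-point clause and its convergence clause on `⁰𝒮`
  obtain ⟨⟨-, -, -, -, -, -, -, -, -, hS1, hconv, -⟩, -⟩ := hB
  -- the Ward identity on the germ, by uniqueness of limits
  have hW : ∀ (n : ℕ), 2 ≤ n → ∀ (F D : 𝓢((Fin n → E4), ℂ)), IsOffDiagonal F →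
      HasCompactSupport (F : (Fin n → E4) → ℂ) →
      (∃ δ : ℝ, 0 < δ ∧ tsupport (F : (Fin n → E4) → ℂ) ⊆ Separated n δ) →
      tsupport (F : (Fin n → E4) → ℂ) ⊆ SmallDiam n r₀ →
      (∀ x, D x = fderiv ℝ (F : (Fin n → E4) → ℂ) x
        (fun k => (x k 0) • (EuclideanSpace.single 1 1 : E4) - (x k 1) • (EuclideanSpace.single 0 1 : E4))) →
      S₁ n D = 0 := by
    intro n hn F D hF hFc hδ hFr hD
    obtain ⟨δ, hδ, hFδ⟩ := hδ
    have hDoff : IsOffDiagonal D :=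
      GermWard.isOffDiagonal_of_tsupport_subset_separated hδ ((tsupport_rotDeriv_subset F D hD).trans hFδ)
    exact tendsto_nhds_unique (hconv n hn D hDoff) (hlat n hn F D hF hFc ⟨δ, hδ, hFδ⟩ hFr hD)
  refine ⟨r₀, hr₀, fun R hdet hR => ?_⟩
  obtain ⟨φ, rfl⟩ := exists_eq_planeRot R hdet hR.1 hR.2
  exact GermWard.germInvariant_planeRot_of_ward S₁ hdens hS1 hW φ

end LatticeWard

/-- **The crux from E0′, NT and the LATTICE rotation Ward identity on the germ** (conditional result):
`OSLegsAtWeakCouplingC` BY NAME from `MomentBounds6` and `LowerBounds` under the crux hypotheses and the lattice form of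
the E1 import — for compact simple `G`, continuous `a` with H1–H3, E0′ and NT in hand, along every scheme in units `a`
with `β_k → ∞` and the bundle's torus ranges there is `r₀ > 0` such that for `n ≥ 2` the lattice `n`-point distributions
of the centred, `a⁻⁴`-renormalised action density annihilate, in the limit, the generator derivative of every compactly
supported, separated, off-diagonal test function of diameter `< r₀` (`germRotAt_of_latticeWardAt`, then
`osLegsAtWeakCouplingC_of_outputs_germRot`). -/
theorem osLegsAtWeakCouplingC_of_outputs_latticeWard
    (hMB : ∀ (G : Type) [Group G] [TopologicalSpace G] [IsTopologicalGroup G] [CompactSpace G]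
      [MeasurableSpace G] [BorelSpace G], IsCompactSimpleLieGroup G →
      ∀ (r : LatticeRep G) (a : ℝ → ℝ), Continuous a → TwoPoint G r a → Skewness G r a → GapInUnits G r a →
        MomentBounds6 G r a)
    (hLB : ∀ (G : Type) [Group G] [TopologicalSpace G] [IsTopologicalGroup G] [CompactSpace G]
      [MeasurableSpace G] [BorelSpace G], IsCompactSimpleLieGroup G →
      ∀ (r : LatticeRep G) (a : ℝ → ℝ), Continuous a → TwoPoint G r a → Skewness G r a → GapInUnits G r a →
        LowerBounds G r a)
    (hlat : ∀ (G : Type) [Group G] [TopologicalSpace G] [IsTopologicalGroup G] [CompactSpace G]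
      [MeasurableSpace G] [BorelSpace G], IsCompactSimpleLieGroup G →
      ∀ (r : LatticeRep G) (a : ℝ → ℝ), Continuous a → TwoPoint G r a → Skewness G r a → GapInUnits G r a →
        MomentBounds6 G r a → LowerBounds G r a →
        ∀ (sch : SpeciesScheme (YMSpecies G)), (∀ k, sch.a k = a (sch.β k)) → Tendsto sch.β atTop atTop →
          (∀ k, 0 ≤ sch.β k ∧ sch.a k ≤ 1 / 24 ∧ 14 ≤ sch.L k ∧ (sch.a k)⁻¹ * (sch.a k)⁻¹ ≤ sch.L k) →
          ∃ r₀ : ℝ, 0 < r₀ ∧ ∀ (n : ℕ), 2 ≤ n → ∀ (F D : 𝓢((Fin n → E4), ℂ)), IsOffDiagonal F →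
            HasCompactSupport (F : (Fin n → E4) → ℂ) →
            (∃ δ : ℝ, 0 < δ ∧ tsupport (F : (Fin n → E4) → ℂ) ⊆ Separated n δ) →
            tsupport (F : (Fin n → E4) → ℂ) ⊆ SmallDiam n r₀ →
            (∀ x, D x = fderiv ℝ (F : (Fin n → E4) → ℂ) x
              (fun k => (x k 0) • (EuclideanSpace.single 1 1 : E4) - (x k 1) • (EuclideanSpace.single 0 1 : E4))) →
            Tendsto (fun k => latticeDist r.ρ (sch.β k) (sch.L k) (sch.a k) r.curvature.F
              (wilsonTorusMean r.ρ (sch.β k) (sch.L k) r.curvature.F) n D) atTop (𝓝 0)) :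
    OSLegsAtWeakCouplingC := by
  refine osLegsAtWeakCouplingC_of_outputs_germRot hMB hLB ?_
  intro G _ _ _ _ _ _ hG r a sch S₁ Tq K b₀ g ha h1 h2 h3 hMB6 hLB' hB _ hdens _
  -- the scheme clauses the lattice statement asks for are bundle clauses
  obtain ⟨⟨hunits, -, -, hβ, -, -, -, -, -, -, -, -, -, -, -, -, hranges, -⟩, -⟩ := id hB
  obtain ⟨r₀, hr₀, hW⟩ := hlat G hG r a ha h1 h2 h3 hMB6 hLB' sch hunits hβ hranges
  exact germRotAt_of_latticeWardAt r a sch S₁ Tq K b₀ g hB hdens hr₀ hW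

end Summit.QuantumFields.YangMills.Cruxes.OSLegsAtWeakCouplingC.Sketch

end
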